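/-
Copyright (c) 2026. All rights reserved.
Released under Apache 2.0 license as described in the file LICENSE.
Authors: abc-iut cell, prover seat abc-iut-w6-d031 (gen 5; PROOF-ONLY: hypothesis (P) of the
[AbsTopIII] Prop 4.2 (i) geometric column at the GENUINE plane domains `ℂ ∖ F`).
-/
import Literature.AnabelianGeometry.AbsoluteAnabelian.ArchimedeanHolFieldFunctorGeometricPSLCuspParabolic
import Literature.AnabelianGeometry.AbsoluteAnabelian.ArchimedeanHolFieldFunctorGeometricPSLUniformisedBasePlane
import HarnessLib

/-!
# Every uniformising group of `ℂ ∖ F` contains a parabolic element (the punctures are cusps)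

S. Mochizuki, *Topics in Absolute Anabelian Geometry III*, proof of Prop. 4.2 (i) (p. 106), at the
uniformised model `X = ℍ/Λ̄`; classical input (H. M. Farkas, I. Kra, *Riemann Surfaces* (1992),
IV.5.5–IV.5.6, IV.6): a puncture of `X` is a cusp of `Λ̄`.  For the GENUINE plane domains
`X = ℂ ∖ F` (`F` finite, non-empty) — the hyperbolic curves of type `(0, |F| + 1)` of the abc-iut cell,
abc-iut-L4-t12's `HolRS.planeComplFinite` — this PROOF-ONLY file (no definitions, no named facts) exhibits
the puncture `p ∈ F` as a holomorphic END `τ ↦ p + (r/2) e^{2πiτ}` in the sense of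
`HolRS.exists_parabolic_mem_of_end` and concludes:

* `HolRS.exists_end_planeComplFinite` — the end at a puncture `p ∈ F` (holomorphic `ℍ → ℂ ∖ F`,
  `1`-periodic, converging to no point of `ℂ ∖ F`);
* ★ `HolRS.exists_parabolic_mem_of_cover_planeComplFinite` — for EVERY holomorphic covering
  `k : ℍ → ℂ ∖ F` whose Möbius deck group `Λ̄` (membership criterion) acts freely, `Λ̄ ∋ π(t)` with
  `t ∈ SL(2, ℝ)` PARABOLIC — hypothesis (P) of abc-iut-L4-d1's
  `HolRS.finiteIndex_subgroupOf_normalizer_of_cusps` at the ABSTRACT deck group, in its binder shape;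
* `HolRS.exists_pslQuotient_iso_planeComplFinite_parabolic` — packaged with abc-iut-w6-d031's
  uniformisation `pslQuotient Λ̄ ≅ planeComplFinite F hF` (`2 ≤ |F|`), and
  `HolRS.exists_pslQuotient_iso_thricePuncturedSphere_parabolic` for `ℂ ∖ {0, 1}`.

MODEL side of [AbsTopIII] §4; the companion hypothesis (FC) («finitely many cusp classes») for the
abstract deck group is NOT proved here (it needs the great Picard theorem); nothing here bears on
[IUTchIII] Cor. 3.12.

## References

* S. Mochizuki, *Topics in Absolute Anabelian Geometry III* (2015), proof of Prop. 4.2 (i) p.106,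
  Def. 4.1 (i) p.101. [MochizukiAbsTopIII2015]
* H. M. Farkas, I. Kra, *Riemann Surfaces*, 2nd ed. (1992), IV.5.5–IV.5.6. [FarkasKra1992]
-/

set_option autoImplicit false

noncomputable section

open Complex Filter Topology Metric Set Function CategoryTheory
open scoped UpperHalfPlane MatrixGroups Manifold ContDiff Real
open UpperHalfPlane (upperHalfPlaneSet isOpen_upperHalfPlaneSet)
open Literature.Analysis.Complex.TranslationEquivariant
open _root_.TopologicalSpace (Opens)
open _root_.MulAction

namespace Literature.AnabelianGeometry.AbsoluteAnabelian

namespace HolRS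

variable {F : Set ℂ}

/-! ### §1 The end of `ℂ ∖ F` at a puncture `p ∈ F` -/

/-- A point of a finite set is isolated: a punctured ball around `p ∈ F` misses `F`.
[cite: MochizukiAbsTopIII2015, Definition 4.1 (i) p.101] -/
theorem exists_radius_of_mem_finite (hF : F.Finite) (p : ℂ) :
    ∃ r : ℝ, 0 < r ∧ ∀ z : ℂ, dist z p < r → z ≠ p → z ∉ F := by
  have hclosed : IsClosed (F \ {p}) := (hF.subset fun z hz => hz.1).isClosed
  have hp' : p ∈ (F \ {p})ᶜ := fun h => h.2 rfl
  obtain ⟨r, hr, hball⟩ := Metric.isOpen_iff.mp hclosed.isOpen_compl p hp'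
  refine ⟨r, hr, fun z hz hzp hzF => ?_⟩
  have : z ∈ (F \ {p})ᶜ := hball (mem_ball.mpr hz)
  exact this ⟨hzF, hzp⟩

/-- The filter «`Im τ → ∞`» on `ℍ` is non-trivial. [folklore] -/
private theorem neBot_comap_im : (comap UpperHalfPlane.im atTop).NeBot := by
  refine atTop_neBot.comap_of_range_mem (mem_atTop_sets.mpr ⟨1, fun b hb => ?_⟩)
  have hb0 : 0 < b := lt_of_lt_of_le one_pos hb
  refine ⟨UpperHalfPlane.mk ((b : ℂ) * I) (by simpa using hb0), ?_⟩
  simp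

/-- **The end of `ℂ ∖ F` at a puncture.**  For `p ∈ F` (`F` finite) there is a holomorphic map
`e : ℍ → ℂ ∖ F`, `e τ = p + (r/2) e^{2πiτ}`, which is `1`-periodic and converges to NO point of `ℂ ∖ F`
as `Im τ → ∞` (in `ℂ` it converges to the puncture `p`). [cite: FarkasKra1992, IV.5.5–IV.5.6]
[cite: MochizukiAbsTopIII2015, Definition 4.1 (i) p.101] -/
theorem exists_end_planeComplFinite (hF : F.Finite) {p : ℂ} (hp : p ∈ F) :
    ∃ e : ℍ → (planeComplFinite F hF).carrier,
      MDifferentiable 𝓘(ℂ, ℂ) 𝓘(ℂ, ℂ) e ∧ (∀ τ τ' : ℍ, (τ' : ℂ) = τ + 1 → e τ' = e τ) ∧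
      ∀ x : (planeComplFinite F hF).carrier, ¬ Tendsto e (comap UpperHalfPlane.im atTop) (𝓝 x) := by
  obtain ⟨r, hr, hiso⟩ := exists_radius_of_mem_finite hF p
  have hr2 : 0 < r / 2 := half_pos hr
  -- the ambient map `g w = p + (r/2) e^{2πiw}`
  let g : ℂ → ℂ := fun w => p + ((r / 2 : ℝ) : ℂ) * exp (2 * π * I * w)
  have hg_diff : Differentiable ℂ g := by
    refine (differentiable_const _).add ((differentiable_const _).mul ?_)
    exact differentiable_exp.comp ((differentiable_const _).mul differentiable_id)
  have hg_sub : ∀ w : ℂ, ‖g w - p‖ = r / 2 * Real.exp (-2 * π * w.im) := fun w => by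
    simp only [g, add_sub_cancel_left, norm_mul, Complex.norm_real, Real.norm_eq_abs,
      abs_of_pos hr2, norm_exp_two_pi_I_mul]
  have hg_lt : ∀ τ : ℍ, ‖g τ - p‖ < r := fun τ => by
    rw [hg_sub]
    have : Real.exp (-2 * π * (τ : ℂ).im) < 1 := by
      rw [← Real.exp_zero, Real.exp_lt_exp]
      have := τ.im_pos
      rw [← UpperHalfPlane.coe_im] at this
      nlinarith [Real.pi_pos]
    nlinarith
  have hg_ne : ∀ τ : ℍ, g τ ≠ p := fun τ h => by
    have h0 : ‖g τ - p‖ = 0 := by rw [h, sub_self, norm_zero]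
    rw [hg_sub] at h0
    have := Real.exp_pos (-2 * π * (τ : ℂ).im)
    nlinarith
  have hg_mem : ∀ τ : ℍ, g τ ∈ ((⟨Fᶜ, hF.isClosed.isOpen_compl⟩ : Opens ℂ) : Set ℂ) := fun τ =>
    hiso (g τ) (by rw [dist_eq_norm]; exact hg_lt τ) (hg_ne τ)
  let e : ℍ → (planeComplFinite F hF).carrier := fun τ => ⟨g τ, hg_mem τ⟩
  have he_coe : ∀ τ : ℍ, (e τ).1 = g τ := fun τ => rfl
  refine ⟨e, fun τ => ?_, fun τ τ' h => ?_, fun x hx => ?_⟩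
  · -- holomorphy: the composite with the inclusion is `g ∘ coe`
    have h1 : MDifferentiableAt 𝓘(ℂ, ℂ) 𝓘(ℂ, ℂ) (Subtype.val ∘ e) τ ↔
        MDifferentiableAt 𝓘(ℂ, ℂ) 𝓘(ℂ, ℂ) e τ :=
      ChartedSpace.liftPropWithinAt_subtypeVal_comp_iff ..
    rw [← h1]
    have h2 : (Subtype.val ∘ e) = fun τ : ℍ => g τ := funext fun τ => rfl
    rw [h2, UpperHalfPlane.mdifferentiableAt_iff]
    have h3 : (fun z : ℂ => g (UpperHalfPlane.ofComplex z)) =ᶠ[𝓝 (τ : ℂ)] g := by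
      filter_upwards [isOpen_upperHalfPlaneSet.mem_nhds τ.im_pos] with z hz
      have hz : 0 < z.im := hz
      rw [UpperHalfPlane.ofComplex_apply_of_im_pos hz, UpperHalfPlane.coe_mk]
    exact ((hg_diff _).congr_of_eventuallyEq h3 :)
  · -- `1`-periodicity
    apply Subtype.ext
    rw [he_coe, he_coe]
    show p + ((r / 2 : ℝ) : ℂ) * exp (2 * π * I * τ') = p + ((r / 2 : ℝ) : ℂ) * exp (2 * π * I * τ)
    rw [h, mul_add, mul_one, Complex.exp_add, Complex.exp_two_pi_mul_I, mul_one]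
  · -- no limit in `ℂ ∖ F`: in `ℂ` the end converges to `p ∈ F`
    haveI := neBot_comap_im
    have hval : Tendsto (fun τ => (e τ).1)
        (comap UpperHalfPlane.im atTop) (𝓝 x.1) :=
      (continuous_subtype_val.tendsto _).comp hx
    have hp_lim : Tendsto (fun τ => (e τ).1)
        (comap UpperHalfPlane.im atTop) (𝓝 p) := by
      rw [tendsto_iff_norm_sub_tendsto_zero]
      have him : Tendsto (fun τ : ℍ => 2 * π * τ.im) (comap UpperHalfPlane.im atTop) atTop :=
        tendsto_comap.const_mul_atTop (by positivity)
      have hexp : Tendsto (fun τ : ℍ => r / 2 * Real.exp (-(2 * π * τ.im)))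
          (comap UpperHalfPlane.im atTop) (𝓝 (r / 2 * 0)) :=
        (Real.tendsto_exp_neg_atTop_nhds_zero.comp him).const_mul _
      rw [mul_zero] at hexp
      refine hexp.congr fun τ => ?_
      rw [he_coe, hg_sub, UpperHalfPlane.coe_im]
      ring_nf
    have hxp : x.1 = p := tendsto_nhds_unique hval hp_lim
    exact x.2 (hxp ▸ hp)

/-! ### §2 Hypothesis (P) at the genuine `ℂ ∖ F` -/

/-- ★ **Every uniformising group of `ℂ ∖ F` contains a parabolic element** (`F` finite, non-empty): for
ANY holomorphic covering `k : ℍ → ℂ ∖ F` whose Möbius deck group `Λ̄` (membership criterion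
`k (q • τ) = k τ`) acts freely, there is a PARABOLIC `t ∈ SL(2, ℝ)` with `π(t) ∈ Λ̄` — hypothesis (P)
of `HolRS.finiteIndex_subgroupOf_normalizer_of_cusps` for the abstract deck group of the genuine
plane domain (the deck transformation of the loop around a puncture).
[cite: FarkasKra1992, IV.5.5–IV.5.6] [cite: MochizukiAbsTopIII2015, Proposition 4.2 (i) proof p.106] -/
theorem exists_parabolic_mem_of_cover_planeComplFinite (hF : F.Finite) (hne : F.Nonempty)
    {k : ℍ → (planeComplFinite F hF).carrier} (hk : IsCoveringMap k)
    (dk : MDifferentiable 𝓘(ℂ, ℂ) 𝓘(ℂ, ℂ) k) (Λ : Subgroup PSL2R) [IsCancelSMul Λ ℍ]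
    (hΛ : ∀ q : PSL2R, q ∈ Λ ↔ ∀ τ : ℍ, k (q • τ) = k τ) :
    ∃ t : SL(2, ℝ), (QuotientGroup.mk' (Subgroup.center SL(2, ℝ)) t : PSL2R) ∈ Λ ∧
      (t : Matrix (Fin 2) (Fin 2) ℝ).IsParabolic := by
  obtain ⟨p, hp⟩ := hne
  obtain ⟨e, de, hper, hend⟩ := exists_end_planeComplFinite hF hp
  exact exists_parabolic_mem_of_end _ hk dk Λ hΛ de hper hend

/-- **`ℂ ∖ F` (`2 ≤ |F|`) is an `ℍ/Λ̄` whose `Λ̄` contains a parabolic element**: abc-iut-w6-d031's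
uniformisation `pslQuotient Λ̄ ≅ planeComplFinite F hF` packaged with hypothesis (P).
[cite: MochizukiAbsTopIII2015, Proposition 4.2 (i) proof p.106] [cite: FarkasKra1992, IV.5.5–IV.5.6] -/
theorem exists_pslQuotient_iso_planeComplFinite_parabolic (hF : F.Finite) (h2 : 2 ≤ F.ncard) :
    ∃ (k : ℍ → (planeComplFinite F hF).carrier) (Λ : Subgroup PSL2R)
      (_ : ProperlyDiscontinuousSMul Λ ℍ) (_ : IsCancelSMul Λ ℍ),
      IsCoveringMap k ∧ MDifferentiable 𝓘(ℂ, ℂ) 𝓘(ℂ, ℂ) k ∧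
      (∀ q : PSL2R, q ∈ Λ ↔ ∀ τ : ℍ, k (q • τ) = k τ) ∧
      IsQuotientCoveringMap k Λ ∧ Nonempty (pslQuotient Λ ≅ planeComplFinite F hF) ∧
      ∃ t : SL(2, ℝ), (QuotientGroup.mk' (Subgroup.center SL(2, ℝ)) t : PSL2R) ∈ Λ ∧
        (t : Matrix (Fin 2) (Fin 2) ℝ).IsParabolic := by
  obtain ⟨k, Λ, hPD, hC, hk, dk, hΛ, hq, -, e, -⟩ := exists_pslQuotient_iso_planeComplFinite hF h2
  have hne : F.Nonempty := Set.nonempty_of_ncard_ne_zero (by omega)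
  exact ⟨k, Λ, hPD, hC, hk, dk, hΛ, hq, ⟨e⟩,
    exists_parabolic_mem_of_cover_planeComplFinite hF hne hk dk Λ hΛ⟩

/-- **The thrice-punctured sphere `ℂ ∖ {0, 1}` is an `ℍ/Λ̄` whose (abstract) `Λ̄` contains a parabolic
element.** [cite: MochizukiAbsTopIII2015, Proposition 4.2 (i) proof p.106]
[cite: FarkasKra1992, IV.5.5–IV.5.6] -/
theorem exists_pslQuotient_iso_thricePuncturedSphere_parabolic :
    ∃ (k : ℍ → (planeComplFinite ({0, 1} : Set ℂ) (Set.toFinite _)).carrier) (Λ : Subgroup PSL2R)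
      (_ : ProperlyDiscontinuousSMul Λ ℍ) (_ : IsCancelSMul Λ ℍ),
      IsCoveringMap k ∧ MDifferentiable 𝓘(ℂ, ℂ) 𝓘(ℂ, ℂ) k ∧
      (∀ q : PSL2R, q ∈ Λ ↔ ∀ τ : ℍ, k (q • τ) = k τ) ∧
      IsQuotientCoveringMap k Λ ∧
      Nonempty (pslQuotient Λ ≅ planeComplFinite ({0, 1} : Set ℂ) (Set.toFinite _)) ∧
      ∃ t : SL(2, ℝ), (QuotientGroup.mk' (Subgroup.center SL(2, ℝ)) t : PSL2R) ∈ Λ ∧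
        (t : Matrix (Fin 2) (Fin 2) ℝ).IsParabolic :=
  exists_pslQuotient_iso_planeComplFinite_parabolic (Set.toFinite _)
    (by rw [Set.ncard_pair (zero_ne_one' ℂ)])

end HolRS

end Literature.AnabelianGeometry.AbsoluteAnabelian

end
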